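import Literature.Barriers.NavierStokesRegularity.NavierStokesInequalityCantorGradient
import HarnessLib

/-!
# Scheffer's Cantor-set switching: `|𝔲|³ ∈ L¹` (Scheffer 1987, Lemma 5.12, velocity part)

Barrier catalogue support file for `NavierStokesRegularity` (D-0021), a further layer of the
decomposition of `Literature.Barriers.NavierStokesRegularity.NavierStokesInequalityNearlyOneDimSingularSet`
(Scheffer 1987 = Ożański 2020 Thm. 1.6), serving the discharge of the remaining local-energy
fact (`NSICantorSwitching`, via the accepted gluing principle `isWeakNSISolution_of_piecewise`): the dominated-convergence step of
the local energy inequality of the glued field needs `|𝔲|³` and `|𝔲||p|` to be integrable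
(Scheffer 1987, Lemma 5.12: "then `∫∫|u|³` and `∫∫|u||p|` are finite. This follows from
Lemma 5.11 [`∇u ∈ L²`, `∫|u|²` nonincreasing], Lemma 5.8 and (5.40) in a standard way. See, for
example, Lemma 3.2 and Lemma 3.6 of [Scheffer 1977]"; Ożański 2017, p. 6: "the regularity
`sup‖u‖ < ∞`, `∇u ∈ L²` gives global-in-time integrability of all the terms"). This file proves
the velocity part for the glued field `𝔲 = glueSeq T τ w` of a Cantor block, by the standard
interpolation `‖u‖₃³ ≤ ‖u‖₂^{3/2}‖u‖₆^{3/2} ≤ K^{3/2}‖u‖₂^{3/2}‖∇u‖₂^{3/2}` (Hölder and the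
whole-space Gagliardo–Nirenberg–Sobolev inequality of the tree, `SobolevWholeSpace`) and Hölder
in time on the finite interval `(0,T₀)`. Everything is PROVED.

## Contents

* `lintegral_enorm_rpow_three_le` — `∫|f|³ ≤ (∫|f|²)^{3/4}(∫|f|⁶)^{1/4}` on any measure space;
* `lintegral_enorm_cube_le_of_contDiff` — for `u ∈ C¹(ℝ³;ℝ³) ∩ L²`:
  `∫|u|³ ≤ K^{3/2} (∫|u|²)^{3/4} (∫|∇u|²_F)^{3/4}`;
* `IsNSICantorBlock.lintegral_enorm_cube_slice_le` — the slice bound for `𝔲(t)` with the uniform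
  energy constant; `IsNSICantorBlock.lintegral_dissipation_slice_rpow_lt_top` —
  `∫₀^{T₀} (∫|∇𝔲(t)|²)^{3/4} dt < ∞` (Hölder in time);
* `IsNSICantorBlock.lintegral_enorm_cube_lt_top` — **`∫∫_{ℝ×ℝ³} |𝔲|³ < ∞`**.

## References

* V. Scheffer, Comm. Math. Phys. 110 (1987), Lemma 5.12. [`Scheffer1987`]
* W. S. Ożański, arXiv:1709.00602 (2017), §2 p. 6. [`Ozanski2017NSISingular`]
* L. Escauriaza, G. Seregin, V. Šverák, Russ. Math. Surveys 58 (2003), (3.7)/(7.10) (the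
  multiplicative inequality). [`EscauriazaSereginSverak2003`]
-/

noncomputable section

open MeasureTheory Set Function Filter Topology TopologicalSpace Metric Module
open Literature.MeasureTheory.Hausdorff Literature.Analysis.FluidPDE
open scoped ENNReal NNReal InnerProductSpace RealInnerProductSpace ContDiff

namespace Literature.Barriers.NavierStokesRegularity

open Scheffer

/-! ### Interpolation -/

/-- **Hölder interpolation at the level of integrals**: `∫ |f|³ ≤ (∫ |f|²)^{3/4} (∫ |f|⁶)^{1/4}`
(`|f|³ = (|f|²)^{3/4} (|f|⁶)^{1/4}` and Hölder with weights `3/4 + 1/4 = 1`). [folklore] -/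
theorem lintegral_enorm_rpow_three_le {α : Type*} [MeasurableSpace α] {μ : Measure α}
    {F : Type*} [NormedAddCommGroup F] {f : α → F} (hf : AEStronglyMeasurable f μ) :
    ∫⁻ a, ‖f a‖ₑ ^ (3 : ℝ) ∂μ ≤
      (∫⁻ a, ‖f a‖ₑ ^ (2 : ℝ) ∂μ) ^ (3 / 4 : ℝ) * (∫⁻ a, ‖f a‖ₑ ^ (6 : ℝ) ∂μ) ^ (1 / 4 : ℝ) := by
  have hm : AEMeasurable (fun a => ‖f a‖ₑ) μ := hf.enorm
  have h := ENNReal.lintegral_mul_norm_pow_le (hm.pow_const (2 : ℝ)) (hm.pow_const (6 : ℝ))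
    (p := 3 / 4) (q := 1 / 4) (by norm_num) (by norm_num) (by norm_num)
  refine le_trans (le_of_eq (lintegral_congr fun a => ?_)) h
  rw [← ENNReal.rpow_mul, ← ENNReal.rpow_mul, ← ENNReal.rpow_add_of_nonneg _ _ (by norm_num)
    (by norm_num)]
  norm_num

/-- **`‖u‖₃³ ≤ K^{3/2} ‖u‖₂^{3/2} ‖∇u‖_{L²,F}^{3/2}` on `ℝ³`** for `C¹` maps with `u ∈ L²`
(Hölder interpolation and the whole-space Sobolev inequality `‖u‖₆ ≤ K‖Du‖₂`,
`K = SNormLESNormFDerivOfEqConst ℝ³ volume 2`; the operator norm of `Du` is dominated by the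
Frobenius norm). The integral form of Scheffer's "standard way" (Lemma 5.12; Escauriaza–
Seregin–Šverák 2003, (7.10)). [cite: EscauriazaSereginSverak2003, (3.7) and (7.10)] -/
theorem lintegral_enorm_cube_le_of_contDiff {u : (EuclideanSpace ℝ (Fin 3)) → (EuclideanSpace ℝ (Fin 3))} (hu : ContDiff ℝ 1 u)
    (hu2 : eLpNorm u 2 volume < ⊤) :
    ∫⁻ x, ‖u x‖ₑ ^ (3 : ℝ) ≤
      (SNormLESNormFDerivOfEqConst (EuclideanSpace ℝ (Fin 3)) (volume : Measure (EuclideanSpace ℝ (Fin 3))) 2 : ℝ≥0∞) ^ (3 / 2 : ℝ) *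
        (∫⁻ x, ‖u x‖ₑ ^ (2 : ℝ)) ^ (3 / 4 : ℝ) *
          (∫⁻ x, ENNReal.ofReal (frobeniusNormSq (fderiv ℝ u x))) ^ (3 / 4 : ℝ) := by
  set K : ℝ≥0∞ := (SNormLESNormFDerivOfEqConst (EuclideanSpace ℝ (Fin 3)) (volume : Measure (EuclideanSpace ℝ (Fin 3))) 2 : ℝ≥0∞) with hK
  have h1 := lintegral_enorm_rpow_three_le (μ := volume) hu.continuous.aestronglyMeasurable
  -- `(∫|u|⁶)^{1/4} = ‖u‖₆^{3/2}`
  have e6 : (∫⁻ x, ‖u x‖ₑ ^ (6 : ℝ)) ^ (1 / 4 : ℝ) = eLpNorm u 6 volume ^ (3 / 2 : ℝ) := by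
    rw [eLpNorm_eq_lintegral_rpow_enorm_toReal (by norm_num) (by norm_num : (6 : ℝ≥0∞) ≠ ⊤),
      ENNReal.toReal_ofNat, ← ENNReal.rpow_mul]
    norm_num
  -- Sobolev: `‖u‖₆ ≤ K ‖Du‖₂`
  have hGNS : eLpNorm u 6 volume ≤ K * eLpNorm (fderiv ℝ u) 2 volume :=
    eLpNorm_six_le_eLpNorm_fderiv_two volume finrank_euclideanSpace_fin hu hu2
  -- `‖Du‖₂ ≤ (∫ |∇u|²_F)^{1/2}`
  have hD : eLpNorm (fderiv ℝ u) 2 volume ≤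
      (∫⁻ x, ENNReal.ofReal (frobeniusNormSq (fderiv ℝ u x))) ^ (1 / 2 : ℝ) := by
    rw [eLpNorm_eq_lintegral_rpow_enorm_toReal two_ne_zero ENNReal.ofNat_ne_top,
      ENNReal.toReal_ofNat]
    refine ENNReal.rpow_le_rpow (lintegral_mono fun x => ?_) (by norm_num)
    rw [ENNReal.rpow_ofNat]
    exact (by rw [← ofReal_norm, ← ENNReal.ofReal_pow (norm_nonneg _)]; exact ENNReal.ofReal_le_ofReal (opNorm_sq_le_frobeniusNormSq_fin3 _))
  have h64 : (∫⁻ x, ‖u x‖ₑ ^ (6 : ℝ)) ^ (1 / 4 : ℝ) ≤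
      K ^ (3 / 2 : ℝ) * (∫⁻ x, ENNReal.ofReal (frobeniusNormSq (fderiv ℝ u x))) ^ (3 / 4 : ℝ) := by
    rw [e6]
    calc eLpNorm u 6 volume ^ (3 / 2 : ℝ)
        ≤ (K * (∫⁻ x, ENNReal.ofReal (frobeniusNormSq (fderiv ℝ u x))) ^ (1 / 2 : ℝ)) ^
            (3 / 2 : ℝ) :=
          ENNReal.rpow_le_rpow (hGNS.trans (mul_le_mul' le_rfl hD)) (by norm_num)
      _ = K ^ (3 / 2 : ℝ) *
            (∫⁻ x, ENNReal.ofReal (frobeniusNormSq (fderiv ℝ u x))) ^ (3 / 4 : ℝ) := by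
          rw [ENNReal.mul_rpow_of_nonneg _ _ (by norm_num), ← ENNReal.rpow_mul]
          norm_num
  calc ∫⁻ x, ‖u x‖ₑ ^ (3 : ℝ)
      ≤ (∫⁻ x, ‖u x‖ₑ ^ (2 : ℝ)) ^ (3 / 4 : ℝ) * (∫⁻ x, ‖u x‖ₑ ^ (6 : ℝ)) ^ (1 / 4 : ℝ) := h1
    _ ≤ (∫⁻ x, ‖u x‖ₑ ^ (2 : ℝ)) ^ (3 / 4 : ℝ) *
          (K ^ (3 / 2 : ℝ) * (∫⁻ x, ENNReal.ofReal (frobeniusNormSq (fderiv ℝ u x))) ^ (3 / 4 : ℝ)) :=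
        mul_le_mul' le_rfl h64
    _ = _ := by ring

namespace IsNSICantorBlock

variable {T ν₀ τ : ℝ} {M : ℕ} {d : Fin M → (EuclideanSpace ℝ (Fin 3))} {G : Set (EuclideanSpace ℝ (Fin 3))} {w : ℕ → ℝ → (EuclideanSpace ℝ (Fin 3)) → (EuclideanSpace ℝ (Fin 3))}

/-! ### The slice bound and the time integral of the dissipation to the power `3/4` -/

/-- **Slice bound**: `∫ |𝔲(t)|³ ≤ K^{3/2} C^{3/4} (∫ |∇𝔲(t)|²)^{3/4}` for EVERY `t`, with the
uniform energy constant `C` of the block (`∫|𝔲(t)|² ≤ C`). [cite: Scheffer1987, Lemma 5.12] -/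
theorem lintegral_enorm_cube_slice_le (h : IsNSICantorBlock T ν₀ τ M d G w) :
    ∃ C : ℝ≥0, ∀ t : ℝ, ∫⁻ x, ‖glueSeq T τ w t x‖ₑ ^ (3 : ℝ) ≤
      (SNormLESNormFDerivOfEqConst (EuclideanSpace ℝ (Fin 3)) (volume : Measure (EuclideanSpace ℝ (Fin 3))) 2 : ℝ≥0∞) ^ (3 / 2 : ℝ) *
        (C : ℝ≥0∞) ^ (3 / 4 : ℝ) *
          (∫⁻ x, ENNReal.ofReal (frobeniusNormSq (fderiv ℝ (glueSeq T τ w t) x))) ^ (3 / 4 : ℝ) := by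
  obtain ⟨C, hC⟩ := h.exists_lintegral_glueSeq_le
  refine ⟨C, fun t => ?_⟩
  have hC2 : ∫⁻ x, ‖glueSeq T τ w t x‖ₑ ^ (2 : ℝ) ≤ C := by
    simpa only [ENNReal.rpow_ofNat] using hC t
  have hu1 : ContDiff ℝ 1 (glueSeq T τ w t) :=
    (h.contDiff_glueSeq t).of_le (by exact_mod_cast le_top)
  have hu2 : eLpNorm (glueSeq T τ w t) 2 volume < ⊤ := by
    rw [eLpNorm_eq_lintegral_rpow_enorm_toReal two_ne_zero ENNReal.ofNat_ne_top,
      ENNReal.toReal_ofNat]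
    exact ENNReal.rpow_lt_top_of_nonneg (by norm_num) (hC2.trans_lt ENNReal.coe_lt_top).ne
  calc ∫⁻ x, ‖glueSeq T τ w t x‖ₑ ^ (3 : ℝ)
      ≤ (SNormLESNormFDerivOfEqConst (EuclideanSpace ℝ (Fin 3)) (volume : Measure (EuclideanSpace ℝ (Fin 3))) 2 : ℝ≥0∞) ^ (3 / 2 : ℝ) *
          (∫⁻ x, ‖glueSeq T τ w t x‖ₑ ^ (2 : ℝ)) ^ (3 / 4 : ℝ) *
            (∫⁻ x, ENNReal.ofReal (frobeniusNormSq (fderiv ℝ (glueSeq T τ w t) x))) ^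
              (3 / 4 : ℝ) := lintegral_enorm_cube_le_of_contDiff hu1 hu2
    _ ≤ _ := by
        gcongr

/-- The dissipation density of the glued field is a.e.-measurable on space–time. [folklore] -/
theorem aemeasurable_frobeniusNormSq_fderiv_glueSeq (h : IsNSICantorBlock T ν₀ τ M d G w) :
    AEMeasurable (fun z : ℝ × (EuclideanSpace ℝ (Fin 3)) => ENNReal.ofReal (frobeniusNormSq (fderiv ℝ (glueSeq T τ w z.1) z.2)))
      (volume : Measure (ℝ × (EuclideanSpace ℝ (Fin 3)))) :=
  ENNReal.measurable_ofReal.comp_aemeasurable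
    ((by unfold frobeniusNormSq; exact continuous_finsetSum _ fun i _ => ((ContinuousLinearMap.apply ℝ (EuclideanSpace ℝ (Fin 3)) (stdOrthonormalBasis ℝ (EuclideanSpace ℝ (Fin 3)) i)).continuous).norm.pow 2 : Continuous fun L : (EuclideanSpace ℝ (Fin 3)) →L[ℝ] (EuclideanSpace ℝ (Fin 3)) => frobeniusNormSq L).comp_aestronglyMeasurable
      h.aestronglyMeasurable_fderiv_glueSeq).aemeasurable

/-- The slice dissipation `t ↦ ∫ |∇𝔲(t)|²` is a.e.-measurable. [folklore] -/
theorem aemeasurable_lintegral_frobeniusNormSq (h : IsNSICantorBlock T ν₀ τ M d G w) :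
    AEMeasurable (fun t : ℝ => ∫⁻ x, ENNReal.ofReal (frobeniusNormSq (fderiv ℝ (glueSeq T τ w t) x)))
      (volume : Measure ℝ) := by
  have hF := h.aemeasurable_frobeniusNormSq_fderiv_glueSeq
  rw [Measure.volume_eq_prod] at hF
  exact hF.lintegral_prod_right'

/-- `∫₀^∞ ∫ |∇𝔲|² dt = ∫∫ |∇𝔲|² < ∞` (Tonelli). [cite: Ozanski2017NSISingular, §2 (2.9)] -/
theorem lintegral_lintegral_frobeniusNormSq_lt_top (h : IsNSICantorBlock T ν₀ τ M d G w) :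
    ∫⁻ t : ℝ, ∫⁻ x, ENNReal.ofReal (frobeniusNormSq (fderiv ℝ (glueSeq T τ w t) x)) < ⊤ := by
  have hF := h.aemeasurable_frobeniusNormSq_fderiv_glueSeq
  rw [Measure.volume_eq_prod] at hF
  have := lintegral_prod _ hF
  rw [← Measure.volume_eq_prod] at this
  rw [← this]
  exact h.lintegral_frobeniusNormSq_fderiv_glueSeq_lt_top

/-- Outside `[0, T₀)` the slice dissipation vanishes (`𝔲 = 0` there). [folklore] -/
theorem lintegral_frobeniusNormSq_slice_eq_zero (h : IsNSICantorBlock T ν₀ τ M d G w) {t : ℝ}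
    (ht : t ∉ Ico (0 : ℝ) (blowupTime T τ)) :
    ∫⁻ x, ENNReal.ofReal (frobeniusNormSq (fderiv ℝ (glueSeq T τ w t) x)) = 0 := by
  have ht' : t ∈ Iio (0 : ℝ) ∪ Ici (blowupTime T τ) := by
    rcases lt_or_ge t 0 with h0 | h0
    · exact Or.inl h0
    · exact Or.inr (not_lt.1 fun h1 => ht ⟨h0, h1⟩)
  simp [glueSeq_eq_zero_of_mem h.T_pos h.τ_pos h.τ_lt_one w ht', frobeniusNormSq_zero]

/-- **Hölder in time on `(0,T₀)`**: `∫ (∫|∇𝔲(t)|²)^{3/4} dt ≤ (∫∫|∇𝔲|²)^{3/4} T₀^{1/4} < ∞`.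
[cite: Scheffer1987, Lemma 5.12] -/
theorem lintegral_dissipation_slice_rpow_lt_top (h : IsNSICantorBlock T ν₀ τ M d G w) :
    ∫⁻ t : ℝ, (∫⁻ x, ENNReal.ofReal (frobeniusNormSq (fderiv ℝ (glueSeq T τ w t) x))) ^ (3 / 4 : ℝ)
      < ⊤ := by
  set D : ℝ → ℝ≥0∞ := fun t => ∫⁻ x, ENNReal.ofReal (frobeniusNormSq (fderiv ℝ (glueSeq T τ w t) x))
    with hD
  set g : ℝ → ℝ≥0∞ := (Ico (0 : ℝ) (blowupTime T τ)).indicator fun _ => 1 with hg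
  have hDm : AEMeasurable D volume := h.aemeasurable_lintegral_frobeniusNormSq
  have hgm : AEMeasurable g volume := (measurable_const.indicator measurableSet_Ico).aemeasurable
  have heq : ∀ t, D t ^ (3 / 4 : ℝ) = D t ^ (3 / 4 : ℝ) * g t ^ (1 / 4 : ℝ) := by
    intro t
    by_cases ht : t ∈ Ico (0 : ℝ) (blowupTime T τ)
    · rw [hg, indicator_of_mem ht, ENNReal.one_rpow, mul_one]
    · rw [hD]
      simp only
      rw [h.lintegral_frobeniusNormSq_slice_eq_zero ht, ENNReal.zero_rpow_of_pos (by norm_num),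
        zero_mul]
  have hH := ENNReal.lintegral_mul_norm_pow_le hDm hgm (p := 3 / 4) (q := 1 / 4)
    (by norm_num) (by norm_num) (by norm_num)
  calc ∫⁻ t, D t ^ (3 / 4 : ℝ) = ∫⁻ t, D t ^ (3 / 4 : ℝ) * g t ^ (1 / 4 : ℝ) :=
        lintegral_congr heq
    _ ≤ (∫⁻ t, D t) ^ (3 / 4 : ℝ) * (∫⁻ t, g t) ^ (1 / 4 : ℝ) := hH
    _ < ⊤ := by
        refine ENNReal.mul_lt_top (ENNReal.rpow_lt_top_of_nonneg (by norm_num)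
          h.lintegral_lintegral_frobeniusNormSq_lt_top.ne) (ENNReal.rpow_lt_top_of_nonneg
          (by norm_num) ?_)
        rw [hg, lintegral_indicator_const measurableSet_Ico, one_mul, Real.volume_Ico]
        exact ENNReal.ofReal_ne_top

/-! ### `|𝔲|³ ∈ L¹(ℝ × ℝ³)` -/

/-- **`∫∫_{ℝ×ℝ³} |𝔲|³ < ∞`** (Scheffer 1987, Lemma 5.12, velocity part; Ożański 2017, p. 6):
Tonelli, the slice bound and Hölder in time. [cite: Scheffer1987, Lemma 5.12] -/
theorem lintegral_enorm_cube_lt_top (h : IsNSICantorBlock T ν₀ τ M d G w) :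
    ∫⁻ z : ℝ × (EuclideanSpace ℝ (Fin 3)), ‖uncurry (glueSeq T τ w) z‖ₑ ^ (3 : ℝ) < ⊤ := by
  obtain ⟨C, hC⟩ := h.lintegral_enorm_cube_slice_le
  set K : ℝ≥0∞ := (SNormLESNormFDerivOfEqConst (EuclideanSpace ℝ (Fin 3)) (volume : Measure (EuclideanSpace ℝ (Fin 3))) 2 : ℝ≥0∞) ^ (3 / 2 : ℝ) *
    (C : ℝ≥0∞) ^ (3 / 4 : ℝ) with hK
  have hKtop : K ≠ ⊤ := ENNReal.mul_ne_top (ENNReal.rpow_ne_top_of_nonneg (by norm_num)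
    ENNReal.coe_ne_top) (ENNReal.rpow_ne_top_of_nonneg (by norm_num) ENNReal.coe_ne_top)
  have hF : AEMeasurable (fun z : ℝ × (EuclideanSpace ℝ (Fin 3)) => ‖uncurry (glueSeq T τ w) z‖ₑ ^ (3 : ℝ))
      ((volume : Measure ℝ).prod (volume : Measure (EuclideanSpace ℝ (Fin 3)))) := by
    rw [← Measure.volume_eq_prod]
    exact (h.aestronglyMeasurable_glueSeq.aemeasurable.enorm.pow_const _)
  rw [Measure.volume_eq_prod, lintegral_prod _ hF]
  calc ∫⁻ t, ∫⁻ x, ‖uncurry (glueSeq T τ w) (t, x)‖ₑ ^ (3 : ℝ)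
      ≤ ∫⁻ t, K * (∫⁻ x, ENNReal.ofReal (frobeniusNormSq (fderiv ℝ (glueSeq T τ w t) x))) ^
          (3 / 4 : ℝ) := lintegral_mono fun t => hC t
    _ = K * ∫⁻ t, (∫⁻ x, ENNReal.ofReal (frobeniusNormSq (fderiv ℝ (glueSeq T τ w t) x))) ^
          (3 / 4 : ℝ) := by
        rw [lintegral_const_mul'' _ (h.aemeasurable_lintegral_frobeniusNormSq.pow_const _)]
    _ < ⊤ := ENNReal.mul_lt_top hKtop.lt_top h.lintegral_dissipation_slice_rpow_lt_top

end IsNSICantorBlock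

end Literature.Barriers.NavierStokesRegularity
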